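import Literature.MathematicalPhysics.QuantumLattice.LatticeGaugeDLRGibbsProofs
import Mathlib.InformationTheory.KullbackLeibler.Basic
import HarnessLib

/-!
# Venture YMGap, track ROBUST-BALL — «C-ENT-BC»: TWO BOUNDARY FIELDS COST ONLY A SURFACE TERM IN RELATIVE ENTROPY, at EVERY coupling

HONEST FRAMING. WHAT THIS IS: a venture file (cell `pub-ymgap`, track Y2 ROBUST-BALL / DS, seat ds-3, theorems only, 0 compute). Generic: every
compact metrisable gauge group `G`, continuous `ρ`, every `d`, every finite link volume `Λ`, every real coupling `b`, two boundary fields `η, η'`.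
The law of the INNER links under the Wilson DLR kernel `γ_Λ^b(·|η)` is the tilt `π_Λ^{b,η} = π_Λ.tilted(−b S_Λ(· ⊕ η))` of the product Haar law
`π_Λ` on `G^Λ` (its image under gluing with `η` is the tree's `ymSpecification ρ b Λ η`). We prove:
* `inner_law_eq_tilted` — `π_Λ^{b,η'} = π_Λ^{b,η}.tilted(−b ΔS_{η→η'})`, `ΔS_{η→η'}(ζ) = S_Λ(ζ ⊕ η') − S_Λ(ζ ⊕ η)`;
* ★★ `klDiv_inner_law_le` — if `|ΔS_{η→η'}| ≤ D` then `KL(π_Λ^{b,η} ‖ π_Λ^{b,η'}) ≤ 2|b|·D`: the relative entropy of the inner configuration under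
  two boundary fields is at most twice `|b|` times the boundary shift — with the `SU(N)` bound `D = 2N · #{plaquettes touching Λ and the
  modification set}` (`BoundaryFactorLipschitz.suN_abs_boundaryShift_le`) a pure SURFACE term, at EVERY coupling, so the relative entropy PER
  PLAQUETTE of two boundary conditions vanishes in the thermodynamic limit (the entropy form of the equivalence of boundary conditions).
* ★ `klDiv_inner_law_haar_eq` — the entropy identity `KL(π_Λ^{b,η} ‖ π_Λ) = −b·γ_Λ^b(S_Λ|η) − log Z_Λ(b|η)` (entropy = coupling × energy − free
  energy) for every boundary field and coupling — the door through which «C-DS-I» (free energy) and its derivative form (energy) give the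
  boundary-uniform SPECIFIC ENTROPY.
MECHANISM: `log dπ^{η}/dπ^{η'} = bΔS − log⟨e^{−bΔS}⟩_{η}` (Mathlib `llr_tilted_right` / `llr_tilted_left`), both terms bounded by `|b|D`.
WHAT THIS IS NOT: no rate in the distance (that is «C-DS-I»/«C-DS-II»), no statement about infinite-volume states; lattice; nothing about the
continuum limit or Clay. References: H.-O. Georgii, *Gibbs Measures and Phase Transitions* (2011) §15.3 (statement type); everything here is
proved. [folklore]
-/

noncomputable section

open MeasureTheory ProbabilityTheory InformationTheory Real Set
open Literature.Probability.LatticeModels hiding configShift configShift_apply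
open Literature.MathematicalPhysics.QuantumLattice
open Literature.MathematicalPhysics.QuantumFieldTheory (haarProbability)

namespace Summit.Ventures.YMGap.RobustBall

namespace BoundaryFreeEnergy

variable {d N : ℕ} {G : Type*} [Group G] [TopologicalSpace G] [IsTopologicalGroup G] [CompactSpace G]
  [MeasurableSpace G] [BorelSpace G] [SecondCountableTopology G] (ρ : G →* Matrix (Fin N) (Fin N) ℂ)

/-- The tilt exponent `ζ ↦ −b S_Λ(ζ ⊕ η)` is measurable and bounded; its exponential is integrable for the product Haar law. [folklore] -/
theorem integrable_exp_neg_mul_action_glueWith (hρ : Continuous ρ) (b : ℝ) (Λ : Finset (ZdEdge d)) (η : LGConfig d G)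
    (μ : Measure (↥Λ → G)) [IsFiniteMeasure μ] :
    Integrable (fun ζ : ↥Λ → G => Real.exp (-b * wilsonBoundaryAction ρ Λ (glueWith Λ ζ η))) μ := by
  have hS : Continuous (wilsonBoundaryAction (G := G) ρ Λ) := continuous_wilsonBoundaryAction ρ hρ Λ
  obtain ⟨C, hC⟩ := exists_bound_of_continuous hS
  have hm : Measurable fun ζ : ↥Λ → G => Real.exp (-b * wilsonBoundaryAction ρ Λ (glueWith Λ ζ η)) :=
    Real.measurable_exp.comp ((hS.measurable.comp (measurable_glueWith Λ η)).const_mul _)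
  refine integrable_of_bound hm.aestronglyMeasurable (C := Real.exp (|b| * C)) fun ζ => ?_
  rw [Real.abs_exp]
  refine Real.exp_le_exp.2 ((le_abs_self _).trans ?_)
  rw [abs_mul, abs_neg]
  exact mul_le_mul_of_nonneg_left (hC _) (abs_nonneg b)

/-- **The inner law under `η'` is a tilt of the inner law under `η` by the boundary shift**:
`π_Λ.tilted(−bS(·⊕η')) = (π_Λ.tilted(−bS(·⊕η))).tilted(−b ΔS_{η→η'})`. [folklore] -/
theorem inner_law_eq_tilted (hρ : Continuous ρ) (b : ℝ) (Λ : Finset (ZdEdge d)) (η η' : LGConfig d G) :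
    (Measure.pi fun _ : ↥Λ => haarProbability G).tilted (fun ζ => -b * wilsonBoundaryAction ρ Λ (glueWith Λ ζ η')) =
      ((Measure.pi fun _ : ↥Λ => haarProbability G).tilted (fun ζ => -b * wilsonBoundaryAction ρ Λ (glueWith Λ ζ η))).tilted
        (fun ζ => -b * (wilsonBoundaryAction ρ Λ (glueWith Λ ζ η') - wilsonBoundaryAction ρ Λ (glueWith Λ ζ η))) := by
  rw [tilted_tilted (integrable_exp_neg_mul_action_glueWith ρ hρ b Λ η _)]
  congr 1
  funext ζ
  simp only [Pi.add_apply]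
  ring

/-- ★★ **«C-ENT-BC»: TWO BOUNDARY FIELDS COST AT MOST `2|b|·D` IN RELATIVE ENTROPY**, `D` any bound on the boundary shift
`|S_Λ(ζ ⊕ η') − S_Λ(ζ ⊕ η)|`: for every compact metrisable `G`, continuous `ρ`, finite `Λ`, real `b` and boundary fields `η, η'`,
`KL(π_Λ^{b,η} ‖ π_Λ^{b,η'}) ≤ 2|b|D` for the laws of the inner links under the two DLR kernels. [folklore] -/
theorem klDiv_inner_law_le (hρ : Continuous ρ) (b : ℝ) (Λ : Finset (ZdEdge d)) {η η' : LGConfig d G} {D : ℝ}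
    (hD : ∀ ζ : ↥Λ → G, |wilsonBoundaryAction ρ Λ (glueWith Λ ζ η') - wilsonBoundaryAction ρ Λ (glueWith Λ ζ η)| ≤ D) :
    klDiv ((Measure.pi fun _ : ↥Λ => haarProbability G).tilted (fun ζ => -b * wilsonBoundaryAction ρ Λ (glueWith Λ ζ η)))
        ((Measure.pi fun _ : ↥Λ => haarProbability G).tilted (fun ζ => -b * wilsonBoundaryAction ρ Λ (glueWith Λ ζ η'))) ≤
      ENNReal.ofReal (2 * |b| * D) := by
  set π₀ : Measure (↥Λ → G) := Measure.pi fun _ : ↥Λ => haarProbability G with hπ₀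
  set μ₁ := π₀.tilted (fun ζ => -b * wilsonBoundaryAction ρ Λ (glueWith Λ ζ η)) with hμ₁
  set g : (↥Λ → G) → ℝ := fun ζ => -b * (wilsonBoundaryAction ρ Λ (glueWith Λ ζ η') - wilsonBoundaryAction ρ Λ (glueWith Λ ζ η))
    with hg
  haveI : IsProbabilityMeasure μ₁ := isProbabilityMeasure_tilted (integrable_exp_neg_mul_action_glueWith ρ hρ b Λ η _)
  have hS : Continuous (wilsonBoundaryAction (G := G) ρ Λ) := continuous_wilsonBoundaryAction ρ hρ Λ
  have hgm : Measurable g :=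
    ((hS.measurable.comp (measurable_glueWith Λ η')).sub (hS.measurable.comp (measurable_glueWith Λ η))).const_mul _
  have hgb : ∀ ζ, |g ζ| ≤ |b| * D := fun ζ => by
    rw [hg, abs_mul, abs_neg]; exact mul_le_mul_of_nonneg_left (hD ζ) (abs_nonneg b)
  have hD0 : 0 ≤ D := (abs_nonneg _).trans (hD fun e => η e)
  have hgi : Integrable g μ₁ := integrable_of_bound hgm.aestronglyMeasurable hgb
  have hegb : ∀ ζ, Real.exp (-(|b| * D)) ≤ Real.exp (g ζ) ∧ Real.exp (g ζ) ≤ Real.exp (|b| * D) := fun ζ =>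
    ⟨Real.exp_le_exp.2 (by linarith [neg_abs_le (g ζ), hgb ζ]), Real.exp_le_exp.2 ((le_abs_self _).trans (hgb ζ))⟩
  have hegi : Integrable (fun ζ => Real.exp (g ζ)) μ₁ :=
    integrable_of_bound (Real.measurable_exp.comp hgm).aestronglyMeasurable (C := Real.exp (|b| * D)) fun ζ => by
      rw [Real.abs_exp]; exact (hegb ζ).2
  -- the second inner law is the tilt of the first by `g`
  have hμ₂ : π₀.tilted (fun ζ => -b * wilsonBoundaryAction ρ Λ (glueWith Λ ζ η')) = μ₁.tilted g :=
    inner_law_eq_tilted ρ hρ b Λ η η'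
  rw [hμ₂]
  -- log-likelihood ratio of a measure against its own tilt
  have hac : μ₁ ≪ μ₁.tilted g := absolutelyContinuous_tilted hegi
  have hllr0 : Integrable (llr μ₁ μ₁) μ₁ := (integrable_zero _ _ _).congr (llr_self μ₁).symm
  have hllr : Integrable (llr μ₁ (μ₁.tilted g)) μ₁ := integrable_llr_tilted_right Measure.AbsolutelyContinuous.rfl hgi hllr0 hegi
  haveI : IsProbabilityMeasure (μ₁.tilted g) := isProbabilityMeasure_tilted hegi
  rw [klDiv_of_ac_of_integrable hac hllr]
  refine ENNReal.ofReal_le_ofReal ?_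
  rw [integral_llr_tilted_right Measure.AbsolutelyContinuous.rfl hgi hegi hllr0, integral_congr_ae (llr_self μ₁)]
  simp only [Pi.zero_apply, integral_zero, probReal_univ, zero_sub, add_sub_cancel_right]
  -- `−∫g ≤ |b| D` and `log ∫ e^g ≤ |b| D`
  have h1 : |∫ ζ, g ζ ∂μ₁| ≤ |b| * D := by
    have h := norm_integral_le_of_norm_le_const (μ := μ₁) (f := g) (C := |b| * D) (ae_of_all _ fun ζ => by
      rw [Real.norm_eq_abs]; exact hgb ζ)
    simpa [Real.norm_eq_abs] using h
  have h2 : Real.log (∫ ζ, Real.exp (g ζ) ∂μ₁) ≤ |b| * D := by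
    have hle : (∫ ζ, Real.exp (g ζ) ∂μ₁) ≤ Real.exp (|b| * D) := by
      have h := integral_mono hegi (integrable_const (Real.exp (|b| * D))) fun ζ => (hegb ζ).2
      simpa using h
    have hpos : 0 < ∫ ζ, Real.exp (g ζ) ∂μ₁ := integral_exp_pos hegi
    have h := Real.log_le_log hpos hle
    rwa [Real.log_exp] at h
  linarith [(abs_le.1 h1).1]

/-- **The mean log-likelihood ratio of the inner law against Haar** is `−b·γ_Λ^b(S_Λ|η) − log Z_Λ(b|η)`, and the log-likelihood ratio is
integrable. [folklore] -/
theorem integral_llr_inner_law_haar_eq (hρ : Continuous ρ) (b : ℝ) (Λ : Finset (ZdEdge d)) (η : LGConfig d G) :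
    Integrable (llr ((Measure.pi fun _ : ↥Λ => haarProbability G).tilted (fun ζ => -b * wilsonBoundaryAction ρ Λ (glueWith Λ ζ η)))
        (Measure.pi fun _ : ↥Λ => haarProbability G))
      ((Measure.pi fun _ : ↥Λ => haarProbability G).tilted (fun ζ => -b * wilsonBoundaryAction ρ Λ (glueWith Λ ζ η))) ∧
    ∫ ζ, llr ((Measure.pi fun _ : ↥Λ => haarProbability G).tilted (fun ζ => -b * wilsonBoundaryAction ρ Λ (glueWith Λ ζ η)))
        (Measure.pi fun _ : ↥Λ => haarProbability G) ζ
        ∂((Measure.pi fun _ : ↥Λ => haarProbability G).tilted (fun ζ => -b * wilsonBoundaryAction ρ Λ (glueWith Λ ζ η))) =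
      -b * (∫ U, wilsonBoundaryAction ρ Λ U ∂(ymSpecification ρ b Λ η)) -
        Real.log (∫ ζ, Real.exp (-b * wilsonBoundaryAction ρ Λ (glueWith Λ ζ η)) ∂(Measure.pi fun _ : ↥Λ => haarProbability G)) := by
  set π₀ : Measure (↥Λ → G) := Measure.pi fun _ : ↥Λ => haarProbability G with hπ₀
  set f : (↥Λ → G) → ℝ := fun ζ => -b * wilsonBoundaryAction ρ Λ (glueWith Λ ζ η) with hf
  have hS : Continuous (wilsonBoundaryAction (G := G) ρ Λ) := continuous_wilsonBoundaryAction ρ hρ Λ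
  obtain ⟨C, hC⟩ := exists_bound_of_continuous hS
  have hfm : Measurable f := (hS.measurable.comp (measurable_glueWith Λ η)).const_mul _
  have hfb : ∀ ζ, |f ζ| ≤ |b| * C := fun ζ => by
    rw [hf, abs_mul, abs_neg]; exact mul_le_mul_of_nonneg_left (hC _) (abs_nonneg b)
  have hef : Integrable (fun ζ => Real.exp (f ζ)) π₀ := integrable_exp_neg_mul_action_glueWith ρ hρ b Λ η π₀
  haveI : IsProbabilityMeasure (π₀.tilted f) := isProbabilityMeasure_tilted hef
  -- log-likelihood ratio of the tilt against its base
  have hllr : llr (π₀.tilted f) π₀ =ᵐ[π₀.tilted f] fun ζ => f ζ - Real.log (∫ z, Real.exp (f z) ∂π₀) := by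
    have h1 := llr_tilted_left (μ := π₀) (ν := π₀) Measure.AbsolutelyContinuous.rfl hef hfm.aemeasurable
    have h2 := llr_self π₀
    have h3 : (llr (π₀.tilted f) π₀) =ᵐ[π₀] fun ζ => f ζ - Real.log (∫ z, Real.exp (f z) ∂π₀) := by
      filter_upwards [h1, h2] with ζ hζ hζ0
      rw [hζ, hζ0, Pi.zero_apply, add_zero]
    exact (tilted_absolutelyContinuous π₀ f).ae_le h3
  have hint : Integrable (llr (π₀.tilted f) π₀) (π₀.tilted f) := by
    refine (integrable_congr hllr).2 ?_
    exact (integrable_of_bound hfm.aestronglyMeasurable hfb).sub (integrable_const _)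
  refine ⟨hint, ?_⟩
  rw [integral_congr_ae hllr, integral_sub (integrable_of_bound hfm.aestronglyMeasurable hfb) (integrable_const _), integral_const,
    probReal_univ, one_smul]
  -- the tilted mean of `f` is `−b` times the kernel energy
  have hmean : ∫ ζ, f ζ ∂(π₀.tilted f) = -b * ∫ U, wilsonBoundaryAction ρ Λ U ∂(ymSpecification ρ b Λ η) := by
    rw [integral_ymSpecification ρ hρ b Λ hS.measurable η, integral_tilted, mul_div_assoc', ← integral_const_mul, ← integral_div]
    refine integral_congr_ae (ae_of_all _ fun ζ => ?_)
    simp only [hf, hπ₀, smul_eq_mul]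
    ring
  rw [hmean]

/-- ★ **GIBBS' INEQUALITY WITH A BOUNDARY FIELD**: `0 ≤ −b·γ_Λ^b(S_Λ|η) − log Z_Λ(b|η)` (the relative entropy of the inner law w.r.t. Haar is
non-negative), every compact `G`, coupling, volume and boundary field. [folklore] -/
theorem neg_mul_kernel_energy_sub_log_normaliser_nonneg (hρ : Continuous ρ) (b : ℝ) (Λ : Finset (ZdEdge d)) (η : LGConfig d G) :
    0 ≤ -b * (∫ U, wilsonBoundaryAction ρ Λ U ∂(ymSpecification ρ b Λ η)) -
        Real.log (∫ ζ, Real.exp (-b * wilsonBoundaryAction ρ Λ (glueWith Λ ζ η)) ∂(Measure.pi fun _ : ↥Λ => haarProbability G)) := by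
  obtain ⟨hint, heq⟩ := integral_llr_inner_law_haar_eq ρ hρ b Λ η
  haveI : IsProbabilityMeasure ((Measure.pi fun _ : ↥Λ => haarProbability G).tilted
      (fun ζ => -b * wilsonBoundaryAction ρ Λ (glueWith Λ ζ η))) :=
    isProbabilityMeasure_tilted (integrable_exp_neg_mul_action_glueWith ρ hρ b Λ η _)
  have h := integral_llr_add_sub_measure_univ_nonneg (tilted_absolutelyContinuous _ _) hint
  rw [heq, probReal_univ, probReal_univ] at h
  linarith

/-- ★ **THE ENTROPY IDENTITY WITH A BOUNDARY FIELD**: the relative entropy of the inner law `π_Λ^{b,η}` with respect to the product Haar law is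
`KL(π_Λ^{b,η} ‖ π_Λ) = −b · γ_Λ^b(S_Λ|η) − log Z_Λ(b|η)` ("entropy = coupling × energy − free energy", finite volume, any boundary field, any coupling,
any compact `G`), in `ℝ≥0∞` and in `ℝ`. [folklore] -/
theorem klDiv_inner_law_haar_eq (hρ : Continuous ρ) (b : ℝ) (Λ : Finset (ZdEdge d)) (η : LGConfig d G) :
    klDiv ((Measure.pi fun _ : ↥Λ => haarProbability G).tilted (fun ζ => -b * wilsonBoundaryAction ρ Λ (glueWith Λ ζ η)))
        (Measure.pi fun _ : ↥Λ => haarProbability G) =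
      ENNReal.ofReal (-b * (∫ U, wilsonBoundaryAction ρ Λ U ∂(ymSpecification ρ b Λ η)) -
        Real.log (∫ ζ, Real.exp (-b * wilsonBoundaryAction ρ Λ (glueWith Λ ζ η)) ∂(Measure.pi fun _ : ↥Λ => haarProbability G))) := by
  obtain ⟨hint, heq⟩ := integral_llr_inner_law_haar_eq ρ hρ b Λ η
  haveI : IsProbabilityMeasure ((Measure.pi fun _ : ↥Λ => haarProbability G).tilted
      (fun ζ => -b * wilsonBoundaryAction ρ Λ (glueWith Λ ζ η))) :=
    isProbabilityMeasure_tilted (integrable_exp_neg_mul_action_glueWith ρ hρ b Λ η _)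
  rw [klDiv_of_ac_of_integrable (tilted_absolutelyContinuous _ _) hint, heq, probReal_univ, probReal_univ]
  congr 1
  ring

/-- The same identity in `ℝ`: `(KL(π_Λ^{b,η} ‖ π_Λ)).toReal = −b·γ_Λ^b(S_Λ|η) − log Z_Λ(b|η)`. [folklore] -/
theorem toReal_klDiv_inner_law_haar_eq (hρ : Continuous ρ) (b : ℝ) (Λ : Finset (ZdEdge d)) (η : LGConfig d G) :
    (klDiv ((Measure.pi fun _ : ↥Λ => haarProbability G).tilted (fun ζ => -b * wilsonBoundaryAction ρ Λ (glueWith Λ ζ η)))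
        (Measure.pi fun _ : ↥Λ => haarProbability G)).toReal =
      -b * (∫ U, wilsonBoundaryAction ρ Λ U ∂(ymSpecification ρ b Λ η)) -
        Real.log (∫ ζ, Real.exp (-b * wilsonBoundaryAction ρ Λ (glueWith Λ ζ η)) ∂(Measure.pi fun _ : ↥Λ => haarProbability G)) := by
  rw [klDiv_inner_law_haar_eq ρ hρ b Λ η, ENNReal.toReal_ofReal (neg_mul_kernel_energy_sub_log_normaliser_nonneg ρ hρ b Λ η)]

end BoundaryFreeEnergy

end Summit.Ventures.YMGap.RobustBall

end
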